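import Summits.ValiantsHypothesis.ValiantsHypothesis.Theorems.MonotoneRestorationOrbitRestorationLinearVolumeQPHalfDegreeTight
import Summits.ValiantsHypothesis.ValiantsHypothesis.Theorems.MonotoneRestorationOrbitRestorationLinearVolumeQPNarrowSpanToDiNarrow
import Summits.ValiantsHypothesis.ValiantsHypothesis.Theorems.MonotoneRestorationOrbitCompressionQPDiClosedOfInvariant
import Summits.ValiantsHypothesis.ValiantsHypothesis.Theorems.MonotoneRestorationOrbitCompressionQPNarrowFloor
import Summits.ValiantsHypothesis.ValiantsHypothesis.Theorems.MonotoneRestorationMonotoneRestorationQPZetaPatterns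
import HarnessLib

/-!
# Route MonotoneRestoration — aside `OrbitCompressionQP` (stmt-ValiantsHypothesis-18332), line
# `expression_compression`: THE REPAIRED FIRST STUB FOLLOWS FROM QUASI-POLYNOMIAL DESCENT ABOVE THE
# INJECTIVE THRESHOLD — the open content of the stub, isolated as ONE level-wise span statement

The repaired first stub (matrix-symmetric `f` + square-symmetric circuits of quasi-polynomial ORBIT size ⇒
closed BIPARTITE labelled pattern expressions with `n^{k+l} ≤ 2^{(log₂ n + c)^c}`) is proved below the
injective threshold (`Theorems/…OrbitToNarrowHalfDegree.lean`: levels with `2 · deg f_n ≤ n`).  This file shows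
that ALL of its remaining content is the following level-wise, circuit-free, `VP`-free statement of
invariant theory — QUASI-POLYNOMIAL DESCENT ABOVE THE THRESHOLD:

  for every `c` there is `c'` such that, on every level `n`, every MATRIX-symmetric polynomial `p` with
  `2 · deg p > n` lying in the span of the ONE-SORTED homomorphism polynomials `dihom_{D,n}` of directed
  looped patterns of treewidth `≤ (log₂ n + c)^c` lies in the span of the BIPARTITE homomorphism
  polynomials `hom_{F,n}` of patterns of treewidth `≤ (log₂ n + c')^{c'}`

(below the threshold this holds with `c' = c`, `SubThresholdDescent.subThreshold_descent`).

* `narrowSpan_mono` — monotonicity of the bipartite narrow span in the width;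
* `qpDescent_of_aboveThreshold` — above-threshold qp-descent ⟹ qp-descent on all levels and degrees;
* ★ `orbitToNarrowExpression_of_qpDescent` — **qp-DESCENT ABOVE THE THRESHOLD ⟹ THE REPAIRED STUB 1 IN
  FULL** (verbatim conclusion of the registered `stub_orbitToNarrowExpression`, for every matrix-symmetric
  family; orbit support ⟹ one-sorted expressions for all `n ≥ 1` — `OrbitSupport.qpOrbitFamily_iff_diNarrow_one`
  — ⟹ one-sorted narrow span by the `k`-label unfolding ⟹ descent ⟹ one closed bipartite expression by K2 and
  linearity; level `n = 1` by the degree floor);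
* `qpOrbit_iff_narrowExpression_of_qpDescent` — under qp-descent, for matrix-symmetric families:
  quasi-polynomial ORBITS ⟺ NARROW BIPARTITE EXPRESSIONS;
* ★ `orbitCompressionQP_of_qpDescent_of_stub2` — **the registered line closes the aside `OrbitCompressionQP`
  modulo its second stub AND above-threshold qp-descent** (both verbatim hypotheses; composition through
  THEOREM ζ-P `qpSymmetric_patternExpr`).

Honest label: a reduction; qp-descent above the threshold (the one-sorted → two-sorted passage S1c for
`deg > n/2`), the second stub, the aside and VP ≠ VNP are NOT proved here.  Helper file
(`--supports stmt-ValiantsHypothesis-18332`); def-free; nothing here is a named fact.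

References: Dawar–Pago–Seppelt 2025 (arXiv:2502.06740) Thm 1.1, Remark p. 17, §7 p. 45; Dwivedi–Pago–Seppelt
2026 (arXiv:2601.09343) Lemma 8.18, Outlook Q3; Dvořák 2010 (treewidth and counting logics).
-/

noncomputable section

open scoped Classical

-- `Summit.ValiantsHypothesis.ValiantsHypothesis.…` is the tree's single-conjunct layout (Sub = Summit).
set_option linter.dupNamespace false

namespace Summit.ValiantsHypothesis.ValiantsHypothesis.Theorems

namespace OrbitToNarrowOfDescent

open Literature.Computability.AlgebraicComplexity MvPolynomial
open Literature.Combinatorics.SimpleGraph (treewidth)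
open Summit.ValiantsHypothesis.ValiantsHypothesis.Theorems.OrbitRestorationQPHomPolyClose

/-! ### The two spans and monotonicity -/

/-- Monotonicity of the bipartite narrow span in the width. [folklore] -/
theorem narrowSpan_mono (n : ℕ) {w w' : ℕ} (h : w ≤ w') :
    Submodule.span ℂ {q : MvPolynomial (Fin n × Fin n) ℂ | ∃ (a b : ℕ) (F : Multiset (Fin a × Fin b)),
        treewidth (SimpleGraph.fromRel fun u v : Fin a ⊕ Fin b =>
            ∃ e ∈ F, u = Sum.inl e.1 ∧ v = Sum.inr e.2) ≤ w ∧ q = homPoly F n ℂ} ≤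
      Submodule.span ℂ {q : MvPolynomial (Fin n × Fin n) ℂ | ∃ (a b : ℕ) (F : Multiset (Fin a × Fin b)),
        treewidth (SimpleGraph.fromRel fun u v : Fin a ⊕ Fin b =>
            ∃ e ∈ F, u = Sum.inl e.1 ∧ v = Sum.inr e.2) ≤ w' ∧ q = homPoly F n ℂ} := by
  refine Submodule.span_mono ?_
  rintro q ⟨a, b, F, hF, rfl⟩
  exact ⟨a, b, F, hF.trans h, rfl⟩

/-- **Above-threshold qp-descent ⟹ qp-descent everywhere** (below the threshold descent holds with the same
width, `SubThresholdDescent.subThreshold_descent`). [folklore] -/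
theorem qpDescent_of_aboveThreshold
    (hdesc : ∀ c : ℕ, ∃ c' : ℕ, ∀ (n : ℕ) (p : MvPolynomial (Fin n × Fin n) ℂ),
      (∀ σ τ : Equiv.Perm (Fin n), rename (fun ij : Fin n × Fin n => (σ ij.1, τ ij.2)) p = p) →
      n < 2 * p.totalDegree →
      p ∈ Submodule.span ℂ {q : MvPolynomial (Fin n × Fin n) ℂ |
        ∃ (a : ℕ) (D : Multiset (Fin a × Fin a)),
          treewidth (SimpleGraph.fromRel fun u v : Fin a => ∃ e ∈ D, u = e.1 ∧ v = e.2) ≤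
            (Nat.log 2 n + c) ^ c ∧ q = diHomPoly D n ℂ} →
      p ∈ Submodule.span ℂ {q : MvPolynomial (Fin n × Fin n) ℂ | ∃ (a b : ℕ) (F : Multiset (Fin a × Fin b)),
        treewidth (SimpleGraph.fromRel fun u v : Fin a ⊕ Fin b =>
            ∃ e ∈ F, u = Sum.inl e.1 ∧ v = Sum.inr e.2) ≤ (Nat.log 2 n + c') ^ c' ∧ q = homPoly F n ℂ}) :
    ∀ c : ℕ, ∃ c' : ℕ, ∀ (n : ℕ) (p : MvPolynomial (Fin n × Fin n) ℂ),
      (∀ σ τ : Equiv.Perm (Fin n), rename (fun ij : Fin n × Fin n => (σ ij.1, τ ij.2)) p = p) →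
      p ∈ Submodule.span ℂ {q : MvPolynomial (Fin n × Fin n) ℂ |
        ∃ (a : ℕ) (D : Multiset (Fin a × Fin a)),
          treewidth (SimpleGraph.fromRel fun u v : Fin a => ∃ e ∈ D, u = e.1 ∧ v = e.2) ≤
            (Nat.log 2 n + c) ^ c ∧ q = diHomPoly D n ℂ} →
      p ∈ Submodule.span ℂ {q : MvPolynomial (Fin n × Fin n) ℂ | ∃ (a b : ℕ) (F : Multiset (Fin a × Fin b)),
        treewidth (SimpleGraph.fromRel fun u v : Fin a ⊕ Fin b =>
            ∃ e ∈ F, u = Sum.inl e.1 ∧ v = Sum.inr e.2) ≤ (Nat.log 2 n + c') ^ c' ∧ q = homPoly F n ℂ} := by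
  intro c
  obtain ⟨c', hc'⟩ := hdesc c
  refine ⟨max c c' + 1, fun n p hp hmem => ?_⟩
  have hpos : 0 < Nat.log 2 n + (max c c' + 1) := by omega
  rcases Nat.lt_or_ge n (2 * p.totalDegree) with hlt | hge
  · exact narrowSpan_mono n (le_trans (Nat.pow_le_pow_left (by omega) c')
      (Nat.pow_le_pow_right hpos (by omega))) (hc' n p hp hlt hmem)
  · exact narrowSpan_mono n (le_trans (Nat.pow_le_pow_left (by omega) c)
      (Nat.pow_le_pow_right hpos (by omega)))
      (SubThresholdDescent.subThreshold_descent n _ p hp hge hmem)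

/-! ### The repaired first stub from qp-descent -/

/-- ★ **qp-DESCENT ABOVE THE THRESHOLD ⟹ THE REPAIRED STUB 1 IN FULL.**  If above-threshold qp-descent holds,
then every MATRIX-symmetric family with square-symmetric circuits of quasi-polynomial orbit size is, for one
constant `c` and every `n ≥ 1`, the closed polynomial of a bipartite labelled pattern expression with
`n^{k+l} ≤ 2^{(log₂ n + c)^c}` — verbatim the conclusion of the registered `stub_orbitToNarrowExpression`.
[cite: DawarPagoSeppelt2025, Theorem 1.1 and §7 (p. 45)] -/
theorem orbitToNarrowExpression_of_qpDescent
    (hdesc : ∀ c : ℕ, ∃ c' : ℕ, ∀ (n : ℕ) (p : MvPolynomial (Fin n × Fin n) ℂ),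
      (∀ σ τ : Equiv.Perm (Fin n), rename (fun ij : Fin n × Fin n => (σ ij.1, τ ij.2)) p = p) →
      n < 2 * p.totalDegree →
      p ∈ Submodule.span ℂ {q : MvPolynomial (Fin n × Fin n) ℂ |
        ∃ (a : ℕ) (D : Multiset (Fin a × Fin a)),
          treewidth (SimpleGraph.fromRel fun u v : Fin a => ∃ e ∈ D, u = e.1 ∧ v = e.2) ≤
            (Nat.log 2 n + c) ^ c ∧ q = diHomPoly D n ℂ} →
      p ∈ Submodule.span ℂ {q : MvPolynomial (Fin n × Fin n) ℂ | ∃ (a b : ℕ) (F : Multiset (Fin a × Fin b)),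
        treewidth (SimpleGraph.fromRel fun u v : Fin a ⊕ Fin b =>
            ∃ e ∈ F, u = Sum.inl e.1 ∧ v = Sum.inr e.2) ≤ (Nat.log 2 n + c') ^ c' ∧ q = homPoly F n ℂ})
    (f : (n : ℕ) → MvPolynomial (Fin n × Fin n) ℂ)
    (hsymm : ∀ (n : ℕ) (σ τ : Equiv.Perm (Fin n)),
      rename (fun ij : Fin n × Fin n => (σ ij.1, τ ij.2)) (f n) = f n)
    (horb : ∃ c : ℕ, ∀ n : ℕ, ∃ (G : Type) (_ : Fintype G)
        (C : LabelledArithCircuit ℂ (Fin n × Fin n) Unit G),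
      C.IsSymmetric (Equiv.Perm (Fin n)) ∧ C.eval (C.output ()) = f n ∧
      C.orbitSize (Equiv.Perm (Fin n)) ≤ 2 ^ ((Nat.log 2 n + c) ^ c)) :
    ∃ c : ℕ, ∀ n : ℕ, 1 ≤ n → ∃ (k l : ℕ) (e : PatternExpr ℂ k l),
      n ^ (k + l) ≤ 2 ^ ((Nat.log 2 n + c) ^ c) ∧ e.close n = f n := by
  obtain ⟨-, c, hc⟩ := (OrbitSupport.qpOrbitFamily_iff_diNarrow_one f).1 horb
  obtain ⟨c', hc'⟩ := qpDescent_of_aboveThreshold hdesc c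
  refine ⟨c' + 5, fun n hn => ?_⟩
  rcases Nat.lt_or_ge n 2 with hn2 | hn2
  · -- `n = 1`: the degree floor (any number of labels costs `1^{k+l} = 1`)
    obtain rfl : n = 1 := by omega
    obtain ⟨e, he⟩ := HomSpan.exists_close_eq_of_matrixSymmetric hn (f 1) (hsymm 1)
    exact ⟨_, _, e, by rw [one_pow]; exact Nat.one_le_two_pow, he⟩
  · -- `n ≥ 2`: unfold the one-sorted expression, descend, close
    obtain ⟨k, e, hk, he⟩ := hc n hn
    have hkL : k ≤ (Nat.log 2 n + c) ^ c := by
      have h2 : 2 ^ k ≤ 2 ^ ((Nat.log 2 n + c) ^ c) := le_trans (Nat.pow_le_pow_left hn2 k) hk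
      exact (Nat.pow_le_pow_iff_right Nat.one_lt_two).1 h2
    have hmem := DiUnfolding.close_mem_diNarrowSpan k n ((Nat.log 2 n + c) ^ c) (by omega) e
    rw [he] at hmem
    obtain ⟨e', he'⟩ :=
      narrowExpression_of_mem_narrowSpan stub_homPoly_close n c' hn (f n) (hc' n (f n) (hsymm n) hmem)
    exact ⟨_, _, e', OrbitRestorationLinearVolumeQPDiNarrow.pow_twice_polylog_le_qp n c', he'⟩

/-- **Under above-threshold qp-descent, for matrix-symmetric families: quasi-polynomial ORBITS ⟺ NARROW
BIPARTITE EXPRESSIONS.** [cite: DawarPagoSeppelt2025, Theorem 1.1 and §7 (p. 45)] -/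
theorem qpOrbit_iff_narrowExpression_of_qpDescent
    (hdesc : ∀ c : ℕ, ∃ c' : ℕ, ∀ (n : ℕ) (p : MvPolynomial (Fin n × Fin n) ℂ),
      (∀ σ τ : Equiv.Perm (Fin n), rename (fun ij : Fin n × Fin n => (σ ij.1, τ ij.2)) p = p) →
      n < 2 * p.totalDegree →
      p ∈ Submodule.span ℂ {q : MvPolynomial (Fin n × Fin n) ℂ |
        ∃ (a : ℕ) (D : Multiset (Fin a × Fin a)),
          treewidth (SimpleGraph.fromRel fun u v : Fin a => ∃ e ∈ D, u = e.1 ∧ v = e.2) ≤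
            (Nat.log 2 n + c) ^ c ∧ q = diHomPoly D n ℂ} →
      p ∈ Submodule.span ℂ {q : MvPolynomial (Fin n × Fin n) ℂ | ∃ (a b : ℕ) (F : Multiset (Fin a × Fin b)),
        treewidth (SimpleGraph.fromRel fun u v : Fin a ⊕ Fin b =>
            ∃ e ∈ F, u = Sum.inl e.1 ∧ v = Sum.inr e.2) ≤ (Nat.log 2 n + c') ^ c' ∧ q = homPoly F n ℂ})
    (f : (n : ℕ) → MvPolynomial (Fin n × Fin n) ℂ)
    (hsymm : ∀ (n : ℕ) (σ τ : Equiv.Perm (Fin n)),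
      rename (fun ij : Fin n × Fin n => (σ ij.1, τ ij.2)) (f n) = f n) :
    (∃ c : ℕ, ∀ n : ℕ, ∃ (G : Type) (_ : Fintype G)
        (C : LabelledArithCircuit ℂ (Fin n × Fin n) Unit G),
      C.IsSymmetric (Equiv.Perm (Fin n)) ∧ C.eval (C.output ()) = f n ∧
      C.orbitSize (Equiv.Perm (Fin n)) ≤ 2 ^ ((Nat.log 2 n + c) ^ c)) ↔
    (∃ c : ℕ, ∀ n : ℕ, 1 ≤ n → ∃ (k l : ℕ) (e : PatternExpr ℂ k l),
      n ^ (k + l) ≤ 2 ^ ((Nat.log 2 n + c) ^ c) ∧ e.close n = f n) :=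
  ⟨orbitToNarrowExpression_of_qpDescent hdesc f hsymm, NarrowToOrbit.qpOrbit_of_narrowExpression' f⟩

/-! ### The registered line modulo Stub 2 and qp-descent -/

/-- ★ **THE LINE `expression_compression` CLOSES THE ASIDE MODULO ITS SECOND STUB AND ABOVE-THRESHOLD
qp-DESCENT** (both verbatim as hypotheses): repaired Stub 1 (this file), Stub 2, THEOREM ζ-P.
[cite: DwivediPagoSeppelt2026, Outlook Q3] [cite: DawarPagoSeppelt2025, §5] -/
theorem orbitCompressionQP_of_qpDescent_of_stub2
    (hdesc : ∀ c : ℕ, ∃ c' : ℕ, ∀ (n : ℕ) (p : MvPolynomial (Fin n × Fin n) ℂ),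
      (∀ σ τ : Equiv.Perm (Fin n), rename (fun ij : Fin n × Fin n => (σ ij.1, τ ij.2)) p = p) →
      n < 2 * p.totalDegree →
      p ∈ Submodule.span ℂ {q : MvPolynomial (Fin n × Fin n) ℂ |
        ∃ (a : ℕ) (D : Multiset (Fin a × Fin a)),
          treewidth (SimpleGraph.fromRel fun u v : Fin a => ∃ e ∈ D, u = e.1 ∧ v = e.2) ≤
            (Nat.log 2 n + c) ^ c ∧ q = diHomPoly D n ℂ} →
      p ∈ Submodule.span ℂ {q : MvPolynomial (Fin n × Fin n) ℂ | ∃ (a b : ℕ) (F : Multiset (Fin a × Fin b)),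
        treewidth (SimpleGraph.fromRel fun u v : Fin a ⊕ Fin b =>
            ∃ e ∈ F, u = Sum.inl e.1 ∧ v = Sum.inr e.2) ≤ (Nat.log 2 n + c') ^ c' ∧ q = homPoly F n ℂ})
    (stub2 : ∀ f : (n : ℕ) → MvPolynomial (Fin n × Fin n) ℂ,
      (∀ (n : ℕ) (σ τ : Equiv.Perm (Fin n)),
        MvPolynomial.rename (fun p : Fin n × Fin n => (σ p.1, τ p.2)) (f n) = f n) →
      IsVPFamily f →
      (∃ c : ℕ, ∀ n : ℕ, 1 ≤ n → ∃ (k l : ℕ) (e : PatternExpr ℂ k l),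
        n ^ (k + l) ≤ 2 ^ ((Nat.log 2 n + c) ^ c) ∧ e.close n = f n) →
      ∃ c : ℕ, ∀ n : ℕ, 1 ≤ n → ∃ (k l : ℕ) (e : PatternExpr ℂ k l),
        n ^ (k + l) ≤ 2 ^ ((Nat.log 2 n + c) ^ c) ∧ e.length ≤ 2 ^ ((Nat.log 2 n + c) ^ c) ∧
        e.close n = f n) :
    Summit.ValiantsHypothesis.ValiantsHypothesis.Theses.MonotoneRestoration.OrbitCompressionQP :=
  fun f hsymm hVP horb =>
    qpSymmetric_patternExpr f (stub2 f hsymm hVP (orbitToNarrowExpression_of_qpDescent hdesc f hsymm horb))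

end OrbitToNarrowOfDescent

end Summit.ValiantsHypothesis.ValiantsHypothesis.Theorems

end
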